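import Summits.AtomisticToContinuum.HydrodynamicLimit.Theses.InformationPercolationEngine
import Literature.MathematicalPhysics.KineticTheory.VelocityBlindPlacement

/-!
# Skeleton of the line `Sketch` (idea `ergodic-window-is-von-neumann`) for the crux
`PercolationClosesChaos` (stmt-AtomisticToContinuum-15178, rev 12:
`KickFairRelEquilibriumMeso → SpectralContractionR → ContactChaos`)

Lead `prover-line-stmt-AtomisticToContinuum-15178-0`, 2026-08-16. Rebuilt from the card
`Cruxes/PercolationClosesChaos/Ideas/ergodic-window-is-von-neumann.md` (§First lemma, §Transfer; the ideator's
`Sketch.lean` evidence file is not mounted in the lead's jail) with the reshapes recorded in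
`Cruxes/PercolationClosesChaos/PICKED.md`:

* the line docks through the CONCLUSION: `ContactChaos → PercolationClosesChaos` (Disproof §1 `crux_of_contactChaos`);
  neither `KickFairRelEquilibriumMeso` nor `SpectralContractionR` is consumed (Disproof F1/F3/F5/F13);
* KINETIC-CELL WINDOW STATISTICS (§1, explicit finite sums / integrals over the hard-sphere prelude, in the format of the
  target's `let`-block): for a flow `Φ : Flow σ N`, a cell of radius `c·ℓ_N` (mean free path `ℓ_N`, bump-localised like the
  target's `bx`) around `x₀ : 𝕋³` and a window of `M` steps of `h·ℓ_N` starting at `s₀`, the window-averaged collision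
  statistic `collWin Ψ` (bump-weighted sum over collisions in the window of the mark test `Ψ(ω, v, w)`, pre-collisional
  marks exactly as in `ContactChaos`), the window-averaged pair-field statistic `pairWin Ξ` (flux-angular average `fluxAvg Ξ`
  against the bump-localised product empirical measure), and the CELL CROSS-RATIO DEFECT
  `cellDefect Ψ = collWin Ψ · pairWin 1 − collWin 1 · pairWin Ψ` — zero in the mean under the invariant law (Gibbs–Palm
  identity: positions ⊥ velocities, collision partners flux ⊗ Maxwellian ⊗ Maxwellian);
* `ErgodicWindowN σ` (§2): under the HOMOGENEOUS INVARIANT torus law `eqLaw σ N Φ = localGibbsLaw σ 1 0 1 N Φ`, for some step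
  `h > 0`, `G_N(|cellDefect| > η) → 0` as `M → ∞` uniformly in large `N`, in the cell position and in the window start —
  the N-uniform equilibrium input of the Donsker–Varadhan transfer (the `entropy-class` card's `ErgodicWindow`);
* `ErgodicShadow σ` (§2): the card's identification, typed as what it delivers: the laws of the four window statistics under
  `G_N` are asymptotically dominated (portmanteau form, closed super-level sets) by the Birkhoff averages of four integrable
  observables of SOME ergodic probability-preserving system whose means satisfy the cross-ratio identity — implied by
  `TimeErgodicKinetic` (time-ergodicity of the low-activity infinite-volume Gibbs state under Alexander's flow, open since
  1975; typed in the card over `InfiniteHardSphereFlow`) together with kinetic-window locality (KWL: the thermodynamic limit of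
  the torus dynamics for local window functionals); `stub_ergodicShadow` carries both;
* the card's §3 LEVER in abstract form is `stub_windowDefectLever` (Birkhoff ⇒ the cross-ratio of Birkhoff averages of four
  integrable observables with `D(means) = 0` tends to `0` in measure) — provable now (tree:
  `Literature.Dynamics.Ergodic.birkhoff_ergodic_theorem_of_ergodic_holds`); the glue `ergodicWindowN_of_shadow` is PROVED here;
* the ENTROPY INEQUALITY for bounded functions is the abstract stub `stub_entropyEventTransfer` (provable now: Mathlib
  `Measure.tilted`, `integral_llr_tilted_right`, as in `Literature.Probability.Entropy.KipnisLandim1999_A1_8_2_holds`);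
* the DV FACTORISATION is `stub_dvTransfer : EntropyEventTransfer → (∀ σ, ErgodicWindowN σ) → KineticCellChaosLG`
  (Hölder over windows, lossless by stationarity of `G_N`; spatial factorisation of one window by finite speed of influence +
  low-activity clustering; budget `H(LG | G_N) ≤ K (N+1)`; collision-count weighting of the bad fraction so that the docking
  needs no further tail input for bad cells);
* the DOCKING is split: `stub_noMesoscopicOscillation` (crux-class conjunct, typed: the collision-weighted cell pair-field
  ratios aggregate to the `r`-ball ratios — "no mesoscopic oscillation of the window-averaged cell velocity laws inside
  `r`-balls"; NOT payable by the entropy budget: a two-stream shear pattern at scale `ℓ√M ≪ s ≪ r` costs `e^{-cNa²}` under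
  `G_N`), `stub_collisionMomentBound` (the route support `CollisionMomentBound`, stmt-AtomisticToContinuum-15144, VERBATIM:
  tails by name, Disproof F15 d2) and `stub_kineticDocking : KineticCellChaosLG → NoMesoscopicOscillation →
  CollisionMomentBound → ContactChaos`.

Composition: `PercolationClosesChaos_of := fun _ _ => stub_kineticDocking (stub_dvTransfer stub_entropyEventTransfer
(fun σ hσ => ergodicWindowN_of_shadow stub_windowDefectLever (stub_ergodicShadow σ hσ))) stub_noMesoscopicOscillation
stub_collisionMomentBound`. Stubs (sorries) ONLY in `stub_*`.
-/

noncomputable section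

open MeasureTheory Set Filter Topology
open scoped ENNReal BigOperators
open Literature.Analysis.FluidPDE Literature.MathematicalPhysics.KineticTheory
open Literature.MathematicalPhysics.KineticTheory.VelocityBlindPlacement
open Summit.AtomisticToContinuum.HydrodynamicLimit.Theses.InformationPercolationEngine

namespace Summit.AtomisticToContinuum.HydrodynamicLimit.Theorems.ErgodicWindowLine

/-! ## §1 Kinetic-cell window statistics -/

/-- Flux-angular average of a mark test `Ξ(ω, v, w)` over impact vectors: `∫_{S²} Ξ(ω, v, w) ((w − v)·ω)₊ dω`
(the target's `Θ`). -/
def fluxAvg (Ξ : V3 × V3 × V3 → ℝ) (v w : V3) : ℝ :=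
  ∫ ω : Metric.sphere (0 : V3) 1, Ξ ((ω : V3), v, w) * hardSphereKernel (w, v) ω ∂sphereMeasure

/-- The homogeneous invariant law `G_N`: the local Gibbs law with constant profiles `a₀ ≡ 1`, `u₀ ≡ 0`, `θ₀ ≡ 1`
(the reference law of `KickFairRelEquilibriumMeso`; invariant under the flow, `map_flow_localGibbsLaw_const`). -/
def eqLaw (σ : ℝ) (N : ℕ) (Φ : Flow σ N) : Measure (Phase N) :=
  localGibbsLaw σ (fun _ => 1) (fun _ => 0) (fun _ => 1) N Φ

/-- WINDOW-AVERAGED CELL COLLISION STATISTIC: `(M h (N+1))⁻¹ Σ_{collision times s ∈ (s₀, s₀ + M h ℓ]} Σ_{ordered contact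
pairs (i, j)} b_{cℓ}(x_i(s), x₀) · Ψ(ε⁻¹(x_i − x_j), v_i⁻, v_j⁻)` — the marks are the target's (`reflectVel` of the
right-continuous velocities = pre-collisional pair, Disproof F6 `contactMark_inner_pos`), the localiser is the target's bump at
the KINETIC scale `c ℓ_N`, the window has `M` steps of `h` mean free paths (`ℓ_N = meanFreePath σ N`, thermal speed `1`).
Normalisation: `Σ_coll b ≍ (N+1)/ℓ` per unit time, so the statistic is `O(1)`. -/
def collWin (Ψ : V3 × V3 × V3 → ℝ) (c h : ℝ) (M : ℕ) (σ : ℝ) (N : ℕ) (Φ : Flow σ N) (z : Phase N)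
    (x₀ : T3) (s₀ : ℝ) : ℝ :=
  let ε := hsDiameter σ N
  let ℓ := meanFreePath σ N
  let G : Geometry (Fin 3) T3 := Torus.geometry (Fin 3)
  let γ : ℝ → Phase N := fun s => Φ.flow s z
  ((M : ℝ) * h * ((N : ℝ) + 1))⁻¹ *
    ∑ᶠ (s : ℝ) (_ : s ∈ collisionTimes G ε γ ∩ Set.Ioc s₀ (s₀ + M * h * ℓ)),
      ∑ i : Fin (N + 1), ∑ j : Fin (N + 1),
        (if i ≠ j ∧ ‖G.sepVec (γ s i).1 (γ s j).1‖ = ε then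
          bump (c * ℓ) (γ s i).1 x₀ *
            Ψ (ε⁻¹ • G.sepVec (γ s i).1 (γ s j).1, reflectVel (G.sepVec (γ s i).1 (γ s j).1) ((γ s i).2, (γ s j).2))
        else 0)

/-- WINDOW-AVERAGED CELL PAIR-FIELD STATISTIC: `(M h ℓ)⁻¹ ∫_{s ∈ (s₀, s₀ + M h ℓ]} ((N+1) ℓ³)² ∫∫ b_{cℓ}(x, x₀) b_{cℓ}(y, x₀)
· fluxAvg Ξ (v, w) d(μ_s ⊗ μ_s)` with `μ_s` the empirical measure of `Φ_s z` — the cell's own (time-averaged, flux-weighted)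
velocity-pair law tested against `Ξ`; `((N+1) ℓ³)²` makes it `O(1)` (`(N+1) ℓ_N³ = (π³σ⁶)⁻¹`). -/
def pairWin (Ξ : V3 × V3 × V3 → ℝ) (c h : ℝ) (M : ℕ) (σ : ℝ) (N : ℕ) (Φ : Flow σ N) (z : Phase N)
    (x₀ : T3) (s₀ : ℝ) : ℝ :=
  let ℓ := meanFreePath σ N
  ((M : ℝ) * h * ℓ)⁻¹ *
    ∫ s in Set.Ioc s₀ (s₀ + M * h * ℓ),
      (((N : ℝ) + 1) * ℓ ^ 3) ^ 2 *
        ∫ p, bump (c * ℓ) p.1.1 x₀ * bump (c * ℓ) p.2.1 x₀ * fluxAvg Ξ p.1.2 p.2.2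
          ∂((empiricalMeasure (Φ.flow s z)).prod (empiricalMeasure (Φ.flow s z)))

/-- THE CELL CROSS-RATIO DEFECT of the mark test `Ψ`: `collWin Ψ · pairWin 1 − collWin 1 · pairWin Ψ` — "the collision marks
of the cell over the window are flux ⊗ (own pair law)-distributed", in the self-normalising cross-ratio format of
`ContactChaos`, at kinetic scale. Zero in the mean under the invariant Gibbs law. -/
def cellDefect (Ψ : V3 × V3 × V3 → ℝ) (c h : ℝ) (M : ℕ) (σ : ℝ) (N : ℕ) (Φ : Flow σ N) (z : Phase N)
    (x₀ : T3) (s₀ : ℝ) : ℝ :=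
  collWin Ψ c h M σ N Φ z x₀ s₀ * pairWin (fun _ => 1) c h M σ N Φ z x₀ s₀ -
    collWin (fun _ => 1) c h M σ N Φ z x₀ s₀ * pairWin Ψ c h M σ N Φ z x₀ s₀

/-- The cross-ratio of a vector of four window averages: `a₀ a₁ − a₂ a₃`. -/
def crossDefect (a : Fin 4 → ℝ) : ℝ := a 0 * a 1 - a 2 * a 3

/-! ## §2 The typed statements of the line -/

/-- `ErgodicWindowN σ` — THE N-UNIFORM EQUILIBRIUM INPUT at reduced density `σ`: for every flow family there is a step `h > 0`
such that for every cell radius `c > 0`, bounded continuous mark test `Ψ` and `η, δ > 0` there is `M₀` with: for every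
`M ≥ M₀`, for all large `N`, uniformly in the cell centre `x₀` and the window start `s₀ ≥ 0`,
`G_N(|cellDefect Ψ c h M| > η) ≤ δ`. -/
def ErgodicWindowN (σ : ℝ) : Prop :=
  ∀ Φ : (N : ℕ) → Flow σ N, ∃ h : ℝ, 0 < h ∧
    ∀ c : ℝ, 0 < c → ∀ Ψ : V3 × V3 × V3 → ℝ, Continuous Ψ → (∃ C : ℝ, ∀ p, |Ψ p| ≤ C) →
      ∀ η δ : ℝ, 0 < η → 0 < δ → ∃ M₀ : ℕ, ∀ M : ℕ, M₀ ≤ M → ∃ N₀ : ℕ, ∀ N : ℕ, N₀ ≤ N →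
        ∀ x₀ : T3, ∀ s₀ : ℝ, 0 ≤ s₀ →
          eqLaw σ N (Φ N) {z | η < |cellDefect Ψ c h M σ N (Φ N) z x₀ s₀|} ≤ ENNReal.ofReal δ

/-- `ErgodicShadow σ` — THE CARD'S IDENTIFICATION, as delivered to the line: for every flow family there is a step `h > 0`
such that for every cell radius `c > 0` and bounded continuous `Ψ` there are a probability space `(Ω, μ)`, an ERGODIC
measure-preserving map `T` and four integrable observables `F j` whose means satisfy the cross-ratio identity
`(∫F₀)(∫F₁) − (∫F₂)(∫F₃) = 0`, such that for every `M` and `η` the `G_N`-probability of `{|cellDefect| > η}` is asymptotically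
(`N → ∞`, uniformly in `x₀`, `s₀ ≥ 0`) at most `μ{|crossDefect (Birkhoff averages over M steps)| ≥ η}` (portmanteau, closed
super-level set). Content = `TimeErgodicKinetic` (time-ergodicity of the low-activity infinite-volume Gibbs state under
Alexander's flow, for the time-`h` map; open since 1975) + KINETIC-WINDOW LOCALITY (thermodynamic limit of the torus dynamics
for the four window functionals) + the Gibbs–Palm identity for the limit means. -/
def ErgodicShadow (σ : ℝ) : Prop :=
  ∀ Φ : (N : ℕ) → Flow σ N, ∃ h : ℝ, 0 < h ∧
    ∀ c : ℝ, 0 < c → ∀ Ψ : V3 × V3 × V3 → ℝ, Continuous Ψ → (∃ C : ℝ, ∀ p, |Ψ p| ≤ C) →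
      ∃ (Ω : Type) (_ : MeasurableSpace Ω) (μ : Measure Ω) (_ : IsProbabilityMeasure μ) (T : Ω → Ω)
        (F : Fin 4 → Ω → ℝ),
        Ergodic T μ ∧ (∀ j, Integrable (F j) μ) ∧
        crossDefect (fun j => ∫ ω, F j ω ∂μ) = 0 ∧
        ∀ (M : ℕ) (η δ : ℝ), 0 < η → 0 < δ → ∃ N₀ : ℕ, ∀ N : ℕ, N₀ ≤ N →
          ∀ x₀ : T3, ∀ s₀ : ℝ, 0 ≤ s₀ →
            eqLaw σ N (Φ N) {z | η < |cellDefect Ψ c h M σ N (Φ N) z x₀ s₀|} ≤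
              μ {ω | η ≤ |crossDefect (fun j => birkhoffAverage ℝ T (F j) M ω)|} + ENNReal.ofReal δ

/-- `KineticCellChaosLG` — KINETIC-CELL CHAOS UNDER LOCAL GIBBS DATA (the output of the Donsker–Varadhan transfer): for
continuous positive profiles there is `σ₀ > 0` such that for `0 < σ < σ₀`, every flow family, horizon `τ > 0`, cell radius
`c > 0`, bounded continuous `Ψ` and `η, δ > 0`, there are a step `h > 0` and `M₀` with: for `M ≥ M₀` and all large `N`,
the `localGibbsLaw`-expectation of the COLLISION-WEIGHTED FRACTION OF BAD (cell, window) PAIRS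
`∫_{x₀ ∈ 𝕋³} (W_N)⁻¹ Σ_{w < W_N} collWin 1 (x₀, w M h ℓ) · 𝟙{|cellDefect Ψ (x₀, w M h ℓ)| > η}` (windows tiling `[0, τ]`,
`W_N = ⌊τ/(M h ℓ_N)⌋`; cell centres averaged over the torus) is at most `δ`. -/
def KineticCellChaosLG : Prop :=
  ∀ (a₀ θ₀ : T3 → ℝ) (u₀ : T3 → V3), Continuous a₀ → Continuous θ₀ → Continuous u₀ →
    (∀ x, 0 < a₀ x) → (∀ x, 0 < θ₀ x) →
    ∃ σ₀ : ℝ, 0 < σ₀ ∧ ∀ σ : ℝ, 0 < σ → σ < σ₀ → ∀ Φ : (N : ℕ) → Flow σ N, ∀ τ : ℝ, 0 < τ →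
      ∀ c : ℝ, 0 < c → ∀ Ψ : V3 × V3 × V3 → ℝ, Continuous Ψ → (∃ C : ℝ, ∀ p, |Ψ p| ≤ C) →
      ∀ η δ : ℝ, 0 < η → 0 < δ → ∃ h : ℝ, 0 < h ∧ ∃ M₀ : ℕ, ∀ M : ℕ, M₀ ≤ M → ∃ N₀ : ℕ, ∀ N : ℕ, N₀ ≤ N →
        let ℓ := meanFreePath σ N
        let W : ℕ := ⌊τ / (M * h * ℓ)⌋₊
        let B : Phase N → ℝ := fun z => ∫ x₀ : T3, (W : ℝ)⁻¹ * ∑ w ∈ Finset.range W,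
          collWin (fun _ => 1) c h M σ N (Φ N) z x₀ (w * (M * h * ℓ)) *
            (if η < |cellDefect Ψ c h M σ N (Φ N) z x₀ (w * (M * h * ℓ))| then 1 else 0)
        ∫⁻ z, ENNReal.ofReal (B z) ∂(localGibbsLaw σ a₀ u₀ θ₀ N (Φ N)) ≤ ENNReal.ofReal δ

/-- `NoMesoscopicOscillation` — THE DOCKING CONJUNCT (crux-class; the line's recorded exposure): the collision-weighted
kinetic-cell pair-field RATIOS aggregate to the `r`-ball pair-field ratios of the target. For continuous positive profiles
there is `σ₀ > 0` such that for `0 < σ < σ₀`, every flow family, `τ > 0`, `c, h > 0`, bounded continuous `Ξ`, and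
`η, δ > 0`, there is `M₀` with: for `M ≥ M₀` there is `r₀ > 0` such that for `0 < r < r₀` and all large `N` the
`localGibbsLaw`-probability that the `(r-ball, window)`-aggregated mismatch
`∫_x ∫_{x₀} b_r(x₀, x) (W)⁻¹ Σ_w collWin 1 (x₀, w) · |pairWin Ξ (x₀, w) · A_r(x, w) − pairWin 1 (x₀, w) · B^Ξ_r(x, w)|`
exceeds `η` is at most `δ`, where `A_r`, `B^Ξ_r` are the target's `r`-mollified pair fields (`bx`, flux-angular average) read
at the window start. Mixture of products versus product of mixtures: it fails for a two-stream shear pattern of amplitude `a`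
at scales `ℓ√M ≪ s ≪ r`, whose cost under `G_N` is only `e^{-cNa²}` — so it is NOT payable by the entropy budget. -/
def NoMesoscopicOscillation : Prop :=
  ∀ (a₀ θ₀ : T3 → ℝ) (u₀ : T3 → V3), Continuous a₀ → Continuous θ₀ → Continuous u₀ →
    (∀ x, 0 < a₀ x) → (∀ x, 0 < θ₀ x) →
    ∃ σ₀ : ℝ, 0 < σ₀ ∧ ∀ σ : ℝ, 0 < σ → σ < σ₀ → ∀ Φ : (N : ℕ) → Flow σ N, ∀ τ : ℝ, 0 < τ →
      ∀ c h : ℝ, 0 < c → 0 < h → ∀ Ξ : V3 × V3 × V3 → ℝ, Continuous Ξ → (∃ C : ℝ, ∀ p, |Ξ p| ≤ C) →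
      ∀ η δ : ℝ, 0 < η → 0 < δ → ∃ M₀ : ℕ, ∀ M : ℕ, M₀ ≤ M → ∃ r₀ : ℝ, 0 < r₀ ∧ ∀ r : ℝ, 0 < r → r < r₀ →
        ∃ N₀ : ℕ, ∀ N : ℕ, N₀ ≤ N →
        let ℓ := meanFreePath σ N
        let W : ℕ := ⌊τ / (M * h * ℓ)⌋₊
        let γ : Phase N → ℝ → Phase N := fun z s => (Φ N).flow s z
        let Pr : (V3 × V3 × V3 → ℝ) → Phase N → ℝ → T3 → ℝ := fun Th z s x =>
          ∫ p, bump r p.1.1 x * bump r p.2.1 x * fluxAvg Th p.1.2 p.2.2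
            ∂((empiricalMeasure (γ z s)).prod (empiricalMeasure (γ z s)))
        let Q : Phase N → ℝ := fun z => ∫ x : T3, ∫ x₀ : T3, bump r x₀ x * ((W : ℝ)⁻¹ * ∑ w ∈ Finset.range W,
          collWin (fun _ => 1) c h M σ N (Φ N) z x₀ (w * (M * h * ℓ)) *
            |pairWin Ξ c h M σ N (Φ N) z x₀ (w * (M * h * ℓ)) * Pr (fun _ => 1) z (w * (M * h * ℓ)) x -
              pairWin (fun _ => 1) c h M σ N (Φ N) z x₀ (w * (M * h * ℓ)) * Pr Ξ z (w * (M * h * ℓ)) x|)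
        localGibbsLaw σ a₀ u₀ θ₀ N (Φ N) {z | η < Q z} ≤ ENNReal.ofReal δ

/-! ## §3 Stubs -/

/-- STUB (provable now; the card's §3 LEVER in abstract form) — for an ergodic probability-preserving map `T` and four
integrable observables whose means satisfy the cross-ratio identity, the cross-ratio of the Birkhoff averages over `M` steps
tends to `0` in measure as `M → ∞` (Birkhoff's theorem coordinatewise — tree
`Literature.Dynamics.Ergodic.birkhoff_ergodic_theorem_of_ergodic_holds` — continuity of `crossDefect`, a.e. ⇒ in measure). -/
theorem stub_windowDefectLever {Ω : Type*} [MeasurableSpace Ω] {μ : Measure Ω} [IsProbabilityMeasure μ]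
    {T : Ω → Ω} (hT : Ergodic T μ) (F : Fin 4 → Ω → ℝ) (hF : ∀ j, Integrable (F j) μ)
    (h0 : (∫ ω, F 0 ω ∂μ) * (∫ ω, F 1 ω ∂μ) - (∫ ω, F 2 ω ∂μ) * (∫ ω, F 3 ω ∂μ) = 0)
    (η : ℝ) (hη : 0 < η) :
    Tendsto (fun M : ℕ => μ {ω | η ≤ |birkhoffAverage ℝ T (F 0) M ω * birkhoffAverage ℝ T (F 1) M ω -
      birkhoffAverage ℝ T (F 2) M ω * birkhoffAverage ℝ T (F 3) M ω|}) atTop (𝓝 0) := by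
  sorry

/-- STUB (provable now; the ENTROPY INEQUALITY for bounded functions, Kipnis–Landim 1999 App. 1 §8 / Donsker–Varadhan) —
for probability measures `μ`, `ν` with `H(μ | ν) = klDiv μ ν < ∞`, a measurable `B` with `0 ≤ B ≤ 1` and `λ > 0`:
`∫ B dμ ≤ (H(μ | ν) + log ∫ e^{λ B} dν) / λ` (Mathlib `Measure.tilted`, `integral_llr_tilted_right`, exactly as in
`Literature.Probability.Entropy.KipnisLandim1999_A1_8_2_holds`). -/
theorem stub_entropyEventTransfer {E : Type*} [MeasurableSpace E] (μ ν : Measure E) [IsProbabilityMeasure μ]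
    [IsProbabilityMeasure ν] (B : E → ℝ) (hB : Measurable B) (hB0 : ∀ x, 0 ≤ B x) (hB1 : ∀ x, B x ≤ 1)
    (lam : ℝ) (hlam : 0 < lam) (hH : InformationTheory.klDiv μ ν ≠ ⊤) :
    ∫ x, B x ∂μ ≤ ((InformationTheory.klDiv μ ν).toReal + Real.log (∫ x, Real.exp (lam * B x) ∂ν)) / lam := by
  sorry

/-- STUB (OPEN CONTENT of the line: `TimeErgodicKinetic` + kinetic-window locality) — `ErgodicShadow σ` at every reduced
density `0 < σ ≤ 1/2` (the probability-measure range of `localGibbsLaw`). Intended proof: kinetic units (`ε_N/ℓ_N = πσ³`,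
`(N+1)ℓ_N³ = (π³σ⁶)⁻¹`, torus side `ℓ_N⁻¹ → ∞`: `hsDiameter_div_meanFreePath`, `card_mul_meanFreePath_cube`,
`tendsto_inv_meanFreePath_atTop`); KWL: the law under `G_N` of the four window statistics of a kinetic cell converges to the
law under the infinite-volume Gibbs state `G_∞` of the corresponding window functionals of Alexander's flow (Alexander 1976
Prop 5.1/Thm 5.2 finite-volume approximation + finite speed of influence in probability + low-activity equivalence of
ensembles; static half `KineticBlowUpStatics`); `TimeErgodicKinetic` (DSS 1989 §4.4: open for every interacting gas in
`d ≥ 2`) makes the time-`hℓ` map ergodic for some `h`; Gibbs–Palm identity for the limit means. -/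
theorem stub_ergodicShadow (σ : ℝ) (hσ : 0 < σ ∧ σ ≤ 1 / 2) : ErgodicShadow σ := by
  sorry

/-- STUB (L–XL; the DONSKER–VARADHAN FACTORISATION) — the entropy inequality and the N-uniform equilibrium input give
kinetic-cell chaos under local Gibbs data: `B` = collision-weighted bad fraction; `E_LG[B] ≤ (H(LG|G_N) + log E_{G_N}
e^{λ(N+1)B})/(λ(N+1))` with `H(LG | G_N) ≤ K(N+1)` (one-body entropy budget, tree `…EntropyBudget`); Hölder over the `W`
windows is lossless by invariance of `G_N` (`map_flow_localGibbsLaw_const`); within one window the cells factorise up to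
`e^{o(N)}` by finite speed of influence under `G_N` (Gaussian velocity tails, collision chains of length `≫ M` exponentially
rare) and low-activity spatial mixing of the hard-sphere Gibbs state; `ErgodicWindowN` bounds the one-cell factor
`1 + (e^{λ'} − 1) p_{M,N}` with `p_{M,N} → 0`; choose `λ = 2K/δ`, then `M`, then `N`. -/
theorem stub_dvTransfer
    (hE : ∀ {E : Type} [MeasurableSpace E] (μ ν : Measure E) [IsProbabilityMeasure μ] [IsProbabilityMeasure ν]
      (B : E → ℝ), Measurable B → (∀ x, 0 ≤ B x) → (∀ x, B x ≤ 1) → ∀ lam : ℝ, 0 < lam →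
      InformationTheory.klDiv μ ν ≠ ⊤ →
      ∫ x, B x ∂μ ≤ ((InformationTheory.klDiv μ ν).toReal + Real.log (∫ x, Real.exp (lam * B x) ∂ν)) / lam)
    (hW : ∀ σ : ℝ, 0 < σ ∧ σ ≤ 1 / 2 → ErgodicWindowN σ) :
    KineticCellChaosLG := by
  sorry

/-- STUB (CRUX-CLASS; the docking conjunct) — `NoMesoscopicOscillation`. Local-equilibrium class: it asserts that the evolved
law carries no `O(1)` velocity-law structure at scales between `ℓ_N √M` and `r` (N → ∞ then r → 0), which neither the
entropy budget nor equilibrium ergodicity controls. Registered so that the disprover can aim at it. -/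
theorem stub_noMesoscopicOscillation : NoMesoscopicOscillation := by
  sorry

/-- STUB (BORROWED ITEM; tails by name) — the route support `CollisionMomentBound` (stmt-AtomisticToContinuum-15144) verbatim:
second velocity moments of the normalised collision functional are tight under local Gibbs data. Discharged by
`CollisionMomentBound_holds` when that item closes; no work inside this line. -/
theorem stub_collisionMomentBound : CollisionMomentBound := by
  sorry

/-- STUB (L; lead) — THE KINETIC DOCKING: kinetic-cell chaos under local Gibbs data, the no-mesoscopic-oscillation conjunct
and the tail input give the target. Intended proof: tile `[0, τ] × 𝕋³` by windows of `M h ℓ_N` and bump-cells of radius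
`c ℓ_N` (partition of unity `∫_{x₀} b_{cℓ}(x_i, x₀) = 1`); on good (cell, window) pairs replace `Σ_coll Ψ` by
`collWin 1 · pairWin Ψ / pairWin 1` (cellDefect ≤ η, denominators bounded below on cells carrying collisions);
`NoMesoscopicOscillation` replaces the cell ratio by the `r`-ball ratio `B^Ψ_r/A_r` of the target; bad pairs weigh `≤ δ`
after collision weighting (`KineticCellChaosLG`); the time-mollifier `bt` and the localiser `χ` vary by `o(1)` over a window /
cell (continuity moduli, `M h ℓ_N → 0`, `c ℓ_N → 0`); fast pairs and the flux moments of `A_r`, `B^Ψ_r` by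
`CollisionMomentBound` + energy conservation; then `N → ∞`, `M → ∞`, `η, δ → 0`, `r → 0` in the target's order. -/
theorem stub_kineticDocking (hK : KineticCellChaosLG) (hO : NoMesoscopicOscillation) (hT : CollisionMomentBound) :
    ContactChaos := by
  sorry

/-! ## §4 Glue (PROVED) and composition -/

/-- GLUE (proved): the abstract lever turns the ergodic shadow into the N-uniform equilibrium input. Choose `M₀` so that
`μ{|crossDefect (Birkhoff_M)| ≥ η} ≤ δ/2` for `M ≥ M₀` (lever), then `N₀(M)` from the shadow with slack `δ/2`. -/
theorem ergodicWindowN_of_shadow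
    (hL : ∀ {Ω : Type} [MeasurableSpace Ω] {μ : Measure Ω} [IsProbabilityMeasure μ] {T : Ω → Ω}, Ergodic T μ →
      ∀ F : Fin 4 → Ω → ℝ, (∀ j, Integrable (F j) μ) →
      (∫ ω, F 0 ω ∂μ) * (∫ ω, F 1 ω ∂μ) - (∫ ω, F 2 ω ∂μ) * (∫ ω, F 3 ω ∂μ) = 0 →
      ∀ η : ℝ, 0 < η → Tendsto (fun M : ℕ => μ {ω | η ≤ |birkhoffAverage ℝ T (F 0) M ω * birkhoffAverage ℝ T (F 1) M ω -
        birkhoffAverage ℝ T (F 2) M ω * birkhoffAverage ℝ T (F 3) M ω|}) atTop (𝓝 0))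
    {σ : ℝ} (hS : ErgodicShadow σ) : ErgodicWindowN σ := by
  intro Φ
  obtain ⟨h, hh, hS⟩ := hS Φ
  refine ⟨h, hh, fun c hc Ψ hΨ hΨb η δ hη hδ => ?_⟩
  obtain ⟨Ω, _, μ, _, T, F, hT, hF, h0, hdom⟩ := hS c hc Ψ hΨ hΨb
  have h0' : (∫ ω, F 0 ω ∂μ) * (∫ ω, F 1 ω ∂μ) - (∫ ω, F 2 ω ∂μ) * (∫ ω, F 3 ω ∂μ) = 0 := h0
  have hlim := hL hT F hF h0' η hη
  have hδ2 : (0 : ℝ≥0∞) < ENNReal.ofReal (δ / 2) := by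
    rw [ENNReal.ofReal_pos]; linarith
  obtain ⟨M₀, hM₀⟩ := (ENNReal.tendsto_atTop_zero.mp hlim) (ENNReal.ofReal (δ / 2)) hδ2
  refine ⟨M₀, fun M hM => ?_⟩
  obtain ⟨N₀, hN₀⟩ := hdom M η (δ / 2) hη (by linarith)
  refine ⟨N₀, fun N hN x₀ s₀ hs₀ => ?_⟩
  calc eqLaw σ N (Φ N) {z | η < |cellDefect Ψ c h M σ N (Φ N) z x₀ s₀|}
      ≤ μ {ω | η ≤ |crossDefect (fun j => birkhoffAverage ℝ T (F j) M ω)|} + ENNReal.ofReal (δ / 2) :=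
        hN₀ N hN x₀ s₀ hs₀
    _ ≤ ENNReal.ofReal (δ / 2) + ENNReal.ofReal (δ / 2) := by
        gcongr
        exact hM₀ M hM
    _ = ENNReal.ofReal δ := by
        rw [← ENNReal.ofReal_add (by linarith) (by linarith)]; ring_nf

/-- The line concludes the crux BY NAME (Disproof §1 `crux_of_contactChaos`: the target alone gives the implication):
shadow ⇒ N-uniform equilibrium input (lever) ⇒ kinetic-cell chaos under local Gibbs data (entropy transfer) ⇒ target
(docking, with the no-oscillation conjunct and the tail input). -/
theorem PercolationClosesChaos_of : PercolationClosesChaos := fun _ _ =>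
  stub_kineticDocking
    (stub_dvTransfer (fun μ ν _ _ B hB h0 h1 lam hlam hH => stub_entropyEventTransfer μ ν B hB h0 h1 lam hlam hH)
      (fun σ hσ => ergodicWindowN_of_shadow
        (fun hT F hF h0 η hη => stub_windowDefectLever hT F hF h0 η hη) (stub_ergodicShadow σ hσ)))
    stub_noMesoscopicOscillation stub_collisionMomentBound

end Summit.AtomisticToContinuum.HydrodynamicLimit.Theorems.ErgodicWindowLine

end
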